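import Literature.MathematicalPhysics.QuantumLattice.QuantumRotorTruncatedGD
import Literature.MathematicalPhysics.QuantumLattice.QuantumRotorTruncatedCommutator
import Literature.MathematicalPhysics.QuantumLattice.HeisenbergOrderNeelInfrared
import HarnessLib

/-!
# Truncated quantum rotators: the ground-state infrared bound from Gaussian domination

Sibling file of `QuantumRotorTruncated.lean`, `QuantumRotorTruncatedGD.lean`,
`QuantumRotorTruncatedCommutator.lean` (item
`provefact-Literature.MathematicalPhysics.QuantumLa-0bccfc6de5`, the named fact
`QuantumRotor.KleinPerez1992_rotorGroundStateLRO`). No statement is touched. This is the rotator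
version of the tree's `XYOrderInfraredProofs.lean` ((GD) ⇒ (A)): the direct ground-state derivation
of the infrared bound of Kennedy–Lieb–Shastry, J. Stat. Phys. 53 (1988), eqs. (12)–(14),
(18)–(19), for the Galerkin matrices `H_M` of the quantum rotators, written — as in
Wojtkiewicz–Pusz–Stachura, Rep. Math. Phys. 77 (2016), §§3.3–3.4 (`g_k² ≤ χ_k 𝓓_k`,
`χ_k` from `E₀(b) ≥ E₀(0)`, `𝓓_k` the double commutator) — for the tracial ground state `ω` of
`H_M = truncHamiltonian M (torusGraph d L).Adj h J`:

* the two Hermitian modes `C_q = Σ_x cos(q·x) cos_x`, `D_q = Σ_x sin(q·x) cos_x` of the first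
  component (`rotorCosMode`, `rotorSinMode`), the Fourier analysis of the field term
  (`rotorGradField_cos`: `V_{cos(q·)} = 2E_q C_q`) and of the field energy (the tree's
  `xyFieldEnergy_cos_add_sin`: `Q(cos) + Q(sin) = 2E_q|Λ|`);
* **(GD) ⇒ infrared bound** (`rotor_infraredBound_of_groundEnergy_le`): if
  `E₀(H_M) ≤ E₀(H_M(b))` for all real fields `b` (proved for even `L ≥ 4` in
  `QuantumRotorTruncatedGD.lean`), then for every `q ≠ 0`,
  `0 ≤ ω(C_q²) + ω(D_q²)` and
  `J (ω(C_q²) + ω(D_q²))² · 8E_q ≤ |Λ| (ω([C_q,[H_M,C_q]]) + ω([D_q,[H_M,D_q]]))`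
  (second-order perturbation theory done variationally, `Matrix.groundState_infraredBound_quadratic`,
  for the two modes, and the discriminant of the sum of the two quadratics);
* **the double commutator bound** (`re_lie_lie_modes_le`): by the exact formula of
  `QuantumRotorTruncatedCommutator.lean` and its operator inequalities, for `M ≥ 1`, `h, J ≥ 0`
  and every `ε > 0`,
  `ω([C_q,[H_M,C_q]]) + ω([D_q,[H_M,D_q]]) ≤ h|Λ| + J (2εd|Λ| + (d/(2ε) + d/2) Σ_x ω(Π_x))`,
  `Π_x = P^x_M + P^x_{-M}` the edge projections (in the continuum the bound is `h|Λ|`, i.e.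
  WPS's `𝓓_k ≤ 1/(4I)` per mode and site).

## References

* [KLS1988JSP] T. Kennedy, E. H. Lieb, B. S. Shastry, J. Stat. Phys. 53 (1988) 1019–1030,
  eqs. (12)–(14), (18)–(19).
* [WojtkiewiczPuszStachura2016] J. Wojtkiewicz, W. Pusz, P. Stachura, Rep. Math. Phys. 77 (2016)
  183–209 (arXiv:1507.03079), §§3.3–3.4, Thm. 3.5.
* [DLS1978] F. J. Dyson, E. H. Lieb, B. Simon, J. Stat. Phys. 18 (1978) 335–383, §3.
-/

noncomputable section

open Matrix Complex Finset
open scoped ComplexOrder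
open Literature.Probability.LatticeModels

namespace Literature.MathematicalPhysics.QuantumLattice

namespace QuantumRotor

attribute [local instance 100] LieRing.ofAssociativeRing

variable {d : ℕ}

/-! ### The two modes and the Fourier analysis of the field term -/

section Modes

variable (L : ℕ) [NeZero L] (M : ℕ)

/-- The cosine mode `C_q = Σ_x cos(q·x) cos_x` of the first component at dual-torus momentum
`q`. [cite: KLS1988JSP, before eq. (12)] [cite: WojtkiewiczPuszStachura2016, §3.3] -/
def rotorCosMode (q : TorusSite d L) : Op (TorusSite d L) (2 * M + 1) :=
  ∑ x : TorusSite d L, (Real.cos (torusPhase L q x) : ℂ) • siteCos M x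

/-- The sine mode `D_q = Σ_x sin(q·x) cos_x`. [cite: KLS1988JSP, before eq. (12)]
[cite: WojtkiewiczPuszStachura2016, §3.3] -/
def rotorSinMode (q : TorusSite d L) : Op (TorusSite d L) (2 * M + 1) :=
  ∑ x : TorusSite d L, (Real.sin (torusPhase L q x) : ℂ) • siteCos M x

/-- A real wave of cosines is Hermitian. [folklore] -/
theorem isHermitian_wave (a : TorusSite d L → ℝ) :
    (∑ x : TorusSite d L, (a x : ℂ) • siteCos M x : Op (TorusSite d L) (2 * M + 1)).IsHermitian := by
  refine (isSelfAdjoint_sum _ fun x _ => Matrix.IsHermitian.isSelfAdjoint ?_).isHermitian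
  rw [IsHermitian, conjTranspose_smul, Complex.star_def, Complex.conj_ofReal,
    (siteCos_isHermitian M x).eq]

/-- `C_q` is Hermitian. [folklore] -/
theorem rotorCosMode_isHermitian (q : TorusSite d L) : (rotorCosMode L M q).IsHermitian :=
  isHermitian_wave L M _

/-- `D_q` is Hermitian. [folklore] -/
theorem rotorSinMode_isHermitian (q : TorusSite d L) : (rotorSinMode L M q).IsHermitian :=
  isHermitian_wave L M _

/-- Summation by parts on the torus: `V_b = Σ_x (Σᵢ (2b_x - b_{x+eᵢ} - b_{x-eᵢ})) cos_x`.
[folklore] -/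
theorem rotorGradField_eq_sum_laplacian (b : TorusSite d L → ℝ) :
    rotorGradField L M b = ∑ x : TorusSite d L,
      ((∑ i : Fin d, (2 * b x - b (x + Pi.single i 1) - b (x - Pi.single i 1)) : ℝ) : ℂ) •
        siteCos M x := by
  have hL : rotorGradField L M b =
      (∑ x : TorusSite d L, ∑ i : Fin d, ((b x - b (x + Pi.single i 1) : ℝ) : ℂ) • siteCos M x) -
        ∑ x : TorusSite d L, ∑ i : Fin d,
          ((b x - b (x + Pi.single i 1) : ℝ) : ℂ) • siteCos M (x + Pi.single i 1) := by
    unfold rotorGradField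
    rw [← sum_sub_distrib]
    refine sum_congr rfl fun x _ => ?_
    rw [← sum_sub_distrib]
    exact sum_congr rfl fun i _ => smul_sub _ _ _
  have hre : ∀ i : Fin d, ∑ x : TorusSite d L,
      ((b x - b (x + Pi.single i 1) : ℝ) : ℂ) • siteCos M (x + Pi.single i 1) =
        ∑ x : TorusSite d L, ((b (x - Pi.single i 1) - b x : ℝ) : ℂ) • siteCos M x := by
    intro i
    rw [← (Equiv.subRight (Pi.single i (1 : ZMod L))).sum_comp]
    refine sum_congr rfl fun x _ => ?_
    simp only [Equiv.subRight_apply, sub_add_cancel]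
  have h2 : ∑ x : TorusSite d L, ∑ i : Fin d,
      ((b x - b (x + Pi.single i 1) : ℝ) : ℂ) • siteCos M (x + Pi.single i 1) =
        ∑ x : TorusSite d L, ∑ i : Fin d, ((b (x - Pi.single i 1) - b x : ℝ) : ℂ) • siteCos M x := by
    rw [sum_comm, sum_congr rfl fun i _ => hre i, sum_comm]
  rw [hL, h2, ← sum_sub_distrib]
  refine sum_congr rfl fun x _ => ?_
  rw [← sum_sub_distrib, Complex.ofReal_sum, sum_smul]
  refine sum_congr rfl fun i _ => ?_
  rw [← sub_smul, ← Complex.ofReal_sub]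
  congr 1
  push_cast
  ring

/-- `V_{cos(q·)} = 2E_q C_q`. [cite: KLS1988JSP, after eq. (19)] [cite: DysonLiebSimon1978, §3] -/
theorem rotorGradField_cos (q : TorusSite d L) :
    rotorGradField L M (fun x => Real.cos (torusPhase L q x)) =
      ((2 * dispersion (latticeMomentum L q) : ℝ) : ℂ) • rotorCosMode L M q := by
  rw [rotorGradField_eq_sum_laplacian, rotorCosMode, smul_sum]
  refine sum_congr rfl fun x _ => ?_
  rw [laplacian_cos_torusPhase, smul_smul, ← Complex.ofReal_mul]

/-- `V_{sin(q·)} = 2E_q D_q`. [folklore] -/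
theorem rotorGradField_sin (q : TorusSite d L) :
    rotorGradField L M (fun x => Real.sin (torusPhase L q x)) =
      ((2 * dispersion (latticeMomentum L q) : ℝ) : ℂ) • rotorSinMode L M q := by
  rw [rotorGradField_eq_sum_laplacian, rotorSinMode, smul_sum]
  refine sum_congr rfl fun x _ => ?_
  rw [laplacian_sin_torusPhase, smul_smul, ← Complex.ofReal_mul]

/-- `V_{t b} = t V_b`. [folklore] -/
theorem rotorGradField_smul (t : ℝ) (b : TorusSite d L → ℝ) :
    rotorGradField L M (t • b) = (t : ℂ) • rotorGradField L M b := by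
  simp only [rotorGradField, Pi.smul_apply, smul_eq_mul, smul_sum, smul_smul, ← mul_sub,
    Complex.ofReal_mul]

/-- `H_M(t b) = H_M + t·(-J V_b) + ½ t² J Q(b)`: the form consumed by
`Matrix.groundState_infraredBound_quadratic`. [folklore] -/
theorem rotorFieldHamiltonian_smul (h J t : ℝ) (b : TorusSite d L → ℝ) :
    rotorFieldHamiltonian L M h J (t • b) =
      truncHamiltonian M (torusGraph d L).Adj h J + (t : ℂ) • (-((J : ℂ) • rotorGradField L M b)) +
        ((t ^ 2 * (J * xyFieldEnergy L b) / 2 : ℝ) : ℂ) • 1 := by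
  rw [rotorFieldHamiltonian, rotorGradField_smul, xyFieldEnergy_smul, smul_neg, smul_smul, smul_smul,
    mul_comm (t : ℂ), sub_eq_add_neg, ← neg_smul]
  congr 2
  push_cast
  ring

end Modes

/-! ### (GD) ⇒ the infrared bound -/

section Infrared

variable (L : ℕ) [NeZero L] (M : ℕ)

/-- **One mode.** If `E₀(H_M) ≤ E₀(H_M(b))` for all fields and `V_b = r W` with `r ≠ 0`, `W`
Hermitian, then for all real `μ`,
`0 ≤ ½ r⁻² J Q(b) + 2μ J² Re ω(W²) + μ² J² Re ω(W (H - E₀) W)`.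
[cite: KLS1988JSP, eqs. (18)–(19)] [cite: WojtkiewiczPuszStachura2016, §3.4] -/
theorem rotor_modeQuadratic_nonneg (h J : ℝ)
    (hGD : ∀ b : TorusSite d L → ℝ,
      (truncHamiltonian M (torusGraph d L).Adj h J).groundEnergy ≤
        (rotorFieldHamiltonian L M h J b).groundEnergy)
    {b : TorusSite d L → ℝ} {W : Op (TorusSite d L) (2 * M + 1)} (hW : W.IsHermitian) {r : ℝ}
    (hVb : rotorGradField L M b = (r : ℂ) • W) (hr : r ≠ 0) (μ : ℝ) :
    0 ≤ r⁻¹ ^ 2 * (J * xyFieldEnergy L b) / 2 +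
      2 * μ * ((truncHamiltonian M (torusGraph d L).Adj h J).groundStateFunctional
        (((J : ℂ) • W) * ((J : ℂ) • W))).re +
      μ ^ 2 * ((truncHamiltonian M (torusGraph d L).Adj h J).groundStateFunctional
        (((J : ℂ) • W) * (truncHamiltonian M (torusGraph d L).Adj h J -
          ((truncHamiltonian M (torusGraph d L).Adj h J).groundEnergy : ℂ) • 1) * ((J : ℂ) • W))).re := by
  set H := truncHamiltonian M (torusGraph d L).Adj h J with hH_def
  have hH : H.IsHermitian := truncHamiltonian_isHermitian M _ h J
  have hV : rotorGradField L M (r⁻¹ • b) = W := by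
    rw [rotorGradField_smul, hVb, smul_smul, ← Complex.ofReal_mul, inv_mul_cancel₀ hr,
      Complex.ofReal_one, one_smul]
  have hQ : xyFieldEnergy L (r⁻¹ • b) = r⁻¹ ^ 2 * xyFieldEnergy L b := xyFieldEnergy_smul L r⁻¹ b
  have hJW : ((J : ℂ) • W).IsHermitian := Matrix.IsHermitian.ofReal_smul hW J
  have key := Matrix.groundState_infraredBound_quadratic hH hJW.neg
    (Q := r⁻¹ ^ 2 * (J * xyFieldEnergy L b)) (fun t => by
      have ht := hGD (t • (r⁻¹ • b))
      rwa [rotorFieldHamiltonian_smul, hV, hQ, show t ^ 2 * (J * (r⁻¹ ^ 2 * xyFieldEnergy L b)) =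
        t ^ 2 * (r⁻¹ ^ 2 * (J * xyFieldEnergy L b)) by ring] at ht) μ
  simpa only [neg_mul, mul_neg, neg_neg] using key

/-- **(GD) ⇒ the infrared bound, rotator version** ([KLS1988JSP] eqs. (12)–(14), (18)–(19);
[WojtkiewiczPuszStachura2016] §3.4, `g_k² ≤ χ_k 𝓓_k` with `χ_k` from Gaussian domination): for side
`L ≥ 3`, `J > 0` and a momentum `q ≠ 0`, if `E₀(H_M) ≤ E₀(H_M(b))` for all real fields `b`, then
with `A = Re ω(C_q²) + Re ω(D_q²)` and `DC = Re ω([C_q,[H_M,C_q]]) + Re ω([D_q,[H_M,D_q]])`,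
`0 ≤ A` and `J A² · 8E_q ≤ L^d · DC`. (The two modes give two quadratic inequalities whose sum has
nonpositive discriminant; `Q(cos) + Q(sin) = 2E_q L^d`.)
[cite: KLS1988JSP, eqs. (12)–(14), (18)–(19)] [cite: WojtkiewiczPuszStachura2016, §3.4] -/
theorem rotor_infraredBound_of_groundEnergy_le (h : ℝ) {J : ℝ} (hJ : 0 < J)
    (hGD : ∀ b : TorusSite d L → ℝ,
      (truncHamiltonian M (torusGraph d L).Adj h J).groundEnergy ≤
        (rotorFieldHamiltonian L M h J b).groundEnergy)
    (q : TorusSite d L) (hq : q ≠ 0) :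
    0 ≤ ((truncHamiltonian M (torusGraph d L).Adj h J).groundStateFunctional
          (rotorCosMode L M q * rotorCosMode L M q)).re +
        ((truncHamiltonian M (torusGraph d L).Adj h J).groundStateFunctional
          (rotorSinMode L M q * rotorSinMode L M q)).re ∧
      J * (((truncHamiltonian M (torusGraph d L).Adj h J).groundStateFunctional
          (rotorCosMode L M q * rotorCosMode L M q)).re +
        ((truncHamiltonian M (torusGraph d L).Adj h J).groundStateFunctional
          (rotorSinMode L M q * rotorSinMode L M q)).re) ^ 2 *
          (8 * dispersion (latticeMomentum L q)) ≤
        (L : ℝ) ^ d *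
          (((truncHamiltonian M (torusGraph d L).Adj h J).groundStateFunctional
              ⁅rotorCosMode L M q, ⁅truncHamiltonian M (torusGraph d L).Adj h J, rotorCosMode L M q⁆⁆).re +
            ((truncHamiltonian M (torusGraph d L).Adj h J).groundStateFunctional
              ⁅rotorSinMode L M q, ⁅truncHamiltonian M (torusGraph d L).Adj h J, rotorSinMode L M q⁆⁆).re) := by
  -- notation
  set H : Op (TorusSite d L) (2 * M + 1) := truncHamiltonian M (torusGraph d L).Adj h J with hH_def
  have hH : H.IsHermitian := truncHamiltonian_isHermitian M _ h J
  set E : ℝ := dispersion (latticeMomentum L q) with hE_def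
  have hE : 0 < E := dispersion_latticeMomentum_pos hq
  set C : Op (TorusSite d L) (2 * M + 1) := rotorCosMode L M q with hC_def
  set D : Op (TorusSite d L) (2 * M + 1) := rotorSinMode L M q with hD_def
  set K : Op (TorusSite d L) (2 * M + 1) := H - (H.groundEnergy : ℂ) • 1 with hK_def
  set aC : ℝ := (H.groundStateFunctional (C * C)).re with haC_def
  set aD : ℝ := (H.groundStateFunctional (D * D)).re with haD_def
  set bC : ℝ := (H.groundStateFunctional (C * K * C)).re with hbC_def
  set bD : ℝ := (H.groundStateFunctional (D * K * D)).re with hbD_def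
  set Qc : ℝ := xyFieldEnergy L (fun x => Real.cos (torusPhase L q x)) with hQc_def
  set Qs : ℝ := xyFieldEnergy L (fun x => Real.sin (torusPhase L q x)) with hQs_def
  have hLd : 0 < (L : ℝ) ^ d := by
    have : (0 : ℝ) < L := by exact_mod_cast Nat.pos_of_ne_zero (NeZero.ne L)
    positivity
  have h2E : (2 * E) ≠ 0 := by positivity
  -- `Re ω((J W)(J W)) = J² Re ω(W W)`, `Re ω((J W) K (J W)) = J² Re ω(W K W)`
  have hsq1 : ∀ W : Op (TorusSite d L) (2 * M + 1),
      (H.groundStateFunctional (((J : ℂ) • W) * ((J : ℂ) • W))).re =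
        J ^ 2 * (H.groundStateFunctional (W * W)).re := by
    intro W
    rw [smul_mul_smul_comm, LinearMap.map_smul, smul_eq_mul, ← Complex.ofReal_mul, Complex.re_ofReal_mul,
      pow_two]
  have hsq2 : ∀ W : Op (TorusSite d L) (2 * M + 1),
      (H.groundStateFunctional (((J : ℂ) • W) * K * ((J : ℂ) • W))).re =
        J ^ 2 * (H.groundStateFunctional (W * K * W)).re := by
    intro W
    rw [Matrix.smul_mul, Matrix.mul_smul, Matrix.smul_mul, smul_smul, LinearMap.map_smul, smul_eq_mul,
      ← Complex.ofReal_mul, Complex.re_ofReal_mul, pow_two]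
  -- the two quadratic inequalities
  have hquadC : ∀ μ : ℝ, 0 ≤ (2 * E)⁻¹ ^ 2 * (J * Qc) / 2 + 2 * μ * (J ^ 2 * aC) + μ ^ 2 * (J ^ 2 * bC) := by
    intro μ
    have h1 := rotor_modeQuadratic_nonneg L M h J hGD (rotorCosMode_isHermitian L M q)
      (rotorGradField_cos L M q) h2E μ
    rwa [hsq1, hsq2] at h1
  have hquadS : ∀ μ : ℝ, 0 ≤ (2 * E)⁻¹ ^ 2 * (J * Qs) / 2 + 2 * μ * (J ^ 2 * aD) + μ ^ 2 * (J ^ 2 * bD) := by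
    intro μ
    have h1 := rotor_modeQuadratic_nonneg L M h J hGD (rotorSinMode_isHermitian L M q)
      (rotorGradField_sin L M q) h2E μ
    rwa [hsq1, hsq2] at h1
  -- their sum and its discriminant
  have hQsum : (2 * E)⁻¹ ^ 2 * (J * Qc) / 2 + (2 * E)⁻¹ ^ 2 * (J * Qs) / 2 = J * (L : ℝ) ^ d / (4 * E) := by
    have hcs := xyFieldEnergy_cos_add_sin L q
    rw [← hQc_def, ← hQs_def, ← hE_def] at hcs
    rw [show (2 * E)⁻¹ ^ 2 * (J * Qc) / 2 + (2 * E)⁻¹ ^ 2 * (J * Qs) / 2 =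
      (2 * E)⁻¹ ^ 2 * J * (Qc + Qs) / 2 by ring, hcs]
    field_simp
    ring
  have hdisc : (J ^ 2 * (aC + aD)) ^ 2 ≤ (J ^ 2 * (bC + bD)) * (J * (L : ℝ) ^ d / (4 * E)) := by
    have hq' : ∀ x : ℝ, 0 ≤ (J ^ 2 * (bC + bD)) * (x * x) + 2 * (J ^ 2 * (aC + aD)) * x +
        J * (L : ℝ) ^ d / (4 * E) := by
      intro x
      have h1 := hquadC x
      have h2 := hquadS x
      rw [← hQsum]
      linarith [h1, h2]
    have hd' := discrim_le_zero hq'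
    rw [discrim] at hd'
    nlinarith [hd']
  -- positivity of `A`
  have haC : 0 ≤ aC := re_groundStateFunctional_mul_self_nonneg H (rotorCosMode_isHermitian L M q)
  have haD : 0 ≤ aD := re_groundStateFunctional_mul_self_nonneg H (rotorSinMode_isHermitian L M q)
  refine ⟨add_nonneg haC haD, ?_⟩
  -- `b = DC / 2`
  have hb : bC + bD = ((H.groundStateFunctional ⁅C, ⁅H, C⁆⁆).re +
      (H.groundStateFunctional ⁅D, ⁅H, D⁆⁆).re) / 2 := by
    rw [hbC_def, hbD_def, hK_def, Matrix.re_groundStateFunctional_conj_eq_lie_lie hH C,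
      Matrix.re_groundStateFunctional_conj_eq_lie_lie hH D, add_div]
  -- `J⁴ A² ≤ J² b · J L^d/(4E)` ⇒ `J A² · 8E ≤ L^d · 2b`
  have hJ2 : 0 < J ^ 2 := by positivity
  have h4E : 0 < 4 * E := by positivity
  have key : J * (aC + aD) ^ 2 * (4 * E) ≤ (bC + bD) * (L : ℝ) ^ d := by
    have h1 : J ^ 4 * (aC + aD) ^ 2 * (4 * E) ≤ J ^ 3 * ((bC + bD) * (L : ℝ) ^ d) := by
      have := mul_le_mul_of_nonneg_right hdisc h4E.le
      calc J ^ 4 * (aC + aD) ^ 2 * (4 * E) = (J ^ 2 * (aC + aD)) ^ 2 * (4 * E) := by ring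
        _ ≤ (J ^ 2 * (bC + bD)) * (J * (L : ℝ) ^ d / (4 * E)) * (4 * E) := this
        _ = J ^ 3 * ((bC + bD) * (L : ℝ) ^ d) := by field_simp
    have h2 : J ^ 3 * (J * (aC + aD) ^ 2 * (4 * E)) ≤ J ^ 3 * ((bC + bD) * (L : ℝ) ^ d) := by
      calc J ^ 3 * (J * (aC + aD) ^ 2 * (4 * E)) = J ^ 4 * (aC + aD) ^ 2 * (4 * E) := by ring
        _ ≤ _ := h1
    exact le_of_mul_le_mul_left h2 (by positivity)
  rw [hb] at key
  nlinarith [key]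

end Infrared

/-! ### The double commutator of the two modes is at most `h L^d` up to edge terms -/

section DoubleCommutatorBound

variable (L : ℕ) [NeZero L] (M : ℕ)

/-- Monotonicity of the tracial ground state: `Y - X ≥ 0 ⇒ Re ω(X) ≤ Re ω(Y)`. [folklore] -/
theorem re_groundStateFunctional_mono {m : Type*} [Fintype m] [DecidableEq m] (A : Matrix m m ℂ)
    {X Y : Matrix m m ℂ} (h : (Y - X).PosSemidef) :
    (A.groundStateFunctional X).re ≤ (A.groundStateFunctional Y).re := by
  have h0 := (Complex.nonneg_iff.mp (groundStateFunctional_nonneg_of_posSemidef A h)).1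
  rw [map_sub, Complex.sub_re] at h0
  linarith

/-- `Y ± X ≥ 0 ⇒ |Re ω(X)| ≤ Re ω(Y)`. [folklore] -/
theorem abs_re_groundStateFunctional_le {m : Type*} [Fintype m] [DecidableEq m] (A : Matrix m m ℂ)
    {X Y : Matrix m m ℂ} (h₁ : (Y - X).PosSemidef) (h₂ : (Y + X).PosSemidef) :
    |(A.groundStateFunctional X).re| ≤ (A.groundStateFunctional Y).re := by
  have ha := re_groundStateFunctional_mono A h₁
  have hb : (A.groundStateFunctional (-X)).re ≤ (A.groundStateFunctional Y).re :=
    re_groundStateFunctional_mono A (by rwa [sub_neg_eq_add])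
  rw [map_neg, Complex.neg_re] at hb
  exact abs_le.2 ⟨by linarith, ha⟩

variable {L M}

/-- The kinetic term in the tracial ground state: `Re ω(2 sin_x² - M Π_x) ≤ 2`. [folklore] -/
theorem re_groundStateFunctional_kinetic_le (h J : ℝ) (x : TorusSite d L) :
    ((truncHamiltonian M (torusGraph d L).Adj h J).groundStateFunctional
      ((2 : ℂ) • (siteSin M x * siteSin M x) - (M : ℂ) • siteEdgeProj M x)).re ≤ 2 := by
  have hH := truncHamiltonian_isHermitian M (torusGraph d L).Adj h J
  have h1 := re_groundStateFunctional_mono (truncHamiltonian M (torusGraph d L).Adj h J)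
    (posSemidef_two_sub_siteCos_doubleCommutator M x)
  rwa [LinearMap.map_smul, groundStateFunctional_one hH, smul_eq_mul, mul_one,
    show ((2 : ℂ)).re = 2 by norm_num] at h1

/-- `Re ω(Π_x) ≥ 0`. [folklore] -/
theorem re_groundStateFunctional_siteEdgeProj_nonneg (h J : ℝ) (x : TorusSite d L) :
    0 ≤ ((truncHamiltonian M (torusGraph d L).Adj h J).groundStateFunctional (siteEdgeProj M x)).re :=
  (Complex.nonneg_iff.mp (groundStateFunctional_nonneg_of_posSemidef _ (posSemidef_siteEdgeProj M x))).1

/-- The first edge term in the tracial ground state: `|Re ω([cos_x, E_x] sin_y)| ≤ ε + Re ω(Π_x)/(4ε)`.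
[folklore] -/
theorem abs_re_groundStateFunctional_edgeTerm_le (hM : 1 ≤ M) (h J : ℝ) {x y : TorusSite d L}
    (hxy : x ≠ y) {ε : ℝ} (hε : 0 < ε) :
    |((truncHamiltonian M (torusGraph d L).Adj h J).groundStateFunctional
        (⁅siteCos M x, ⁅siteCos M x, siteSin M x⁆⁆ * siteSin M y)).re| ≤
      ε + ε⁻¹ / 4 * ((truncHamiltonian M (torusGraph d L).Adj h J).groundStateFunctional
        (siteEdgeProj M x)).re := by
  have hH := truncHamiltonian_isHermitian M (torusGraph d L).Adj h J
  obtain ⟨h1, h2⟩ := posSemidef_edgeTerm (M := M) hM hxy hε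
  have h3 := abs_re_groundStateFunctional_le (truncHamiltonian M (torusGraph d L).Adj h J) h1 h2
  rwa [map_add, LinearMap.map_smul, LinearMap.map_smul, groundStateFunctional_one hH, smul_eq_mul,
    mul_one, smul_eq_mul, Complex.add_re, Complex.ofReal_re, Complex.re_ofReal_mul] at h3

/-- The second edge term: `|Re ω(sin_x [cos_y, E_y])| ≤ ε + Re ω(Π_y)/(4ε)` (the first with the
roles of `x`, `y` exchanged; the factors commute). [folklore] -/
theorem abs_re_groundStateFunctional_edgeTerm_le' (hM : 1 ≤ M) (h J : ℝ) {x y : TorusSite d L}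
    (hxy : x ≠ y) {ε : ℝ} (hε : 0 < ε) :
    |((truncHamiltonian M (torusGraph d L).Adj h J).groundStateFunctional
        (siteSin M x * ⁅siteCos M y, ⁅siteCos M y, siteSin M y⁆⁆)).re| ≤
      ε + ε⁻¹ / 4 * ((truncHamiltonian M (torusGraph d L).Adj h J).groundStateFunctional
        (siteEdgeProj M y)).re := by
  have hc : siteSin M x * ⁅siteCos M y, ⁅siteCos M y, siteSin M y⁆⁆ =
      ⁅siteCos M y, ⁅siteCos M y, siteSin M y⁆⁆ * siteSin M x := by
    rw [lie_siteCos_siteSin, siteCos, lie_onSite_onSite, siteSin]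
    exact onSite_mul_onSite_comm hxy _ _
  rw [hc]
  exact abs_re_groundStateFunctional_edgeTerm_le hM h J (Ne.symm hxy) hε

/-- The edge product: `|Re ω(E_x E_y)| ≤ (Re ω(Π_x) + Re ω(Π_y))/8`. [folklore] -/
theorem abs_re_groundStateFunctional_edgeProd_le (hM : 1 ≤ M) (h J : ℝ) {x y : TorusSite d L}
    (hxy : x ≠ y) :
    |((truncHamiltonian M (torusGraph d L).Adj h J).groundStateFunctional
        (⁅siteCos M x, siteSin M x⁆ * ⁅siteCos M y, siteSin M y⁆)).re| ≤
      (((truncHamiltonian M (torusGraph d L).Adj h J).groundStateFunctional (siteEdgeProj M x)).re +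
        ((truncHamiltonian M (torusGraph d L).Adj h J).groundStateFunctional (siteEdgeProj M y)).re) / 8 := by
  obtain ⟨h1, h2⟩ := posSemidef_edgeProd (M := M) hM hxy
  have h3 := abs_re_groundStateFunctional_le (truncHamiltonian M (torusGraph d L).Adj h J) h1 h2
  rw [LinearMap.map_smul, smul_eq_mul, Complex.re_ofReal_mul, map_add, Complex.add_re] at h3
  linarith

variable (L M)

/-- **The double commutator in the tracial ground state, exactly**, for a real wave
`A = Σ_u a_u cos_u`:
`Re ω([A,[H_M,A]]) = Σ_x (h/2) a_x² Re ω(2 sin_x² - M Π_x)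
  + Σ_x Σ_{y ∼ x} (J/2)(a_x² Re ω([cos_x,E_x] sin_y) + a_y² Re ω(sin_x [cos_y,E_y]) + 2a_x a_y Re ω(E_x E_y))`.
[cite: KLS1988JSP, eq. (13)] -/
theorem re_groundStateFunctional_lie_lie_wave (h J : ℝ) (a : TorusSite d L → ℝ) :
    ((truncHamiltonian M (torusGraph d L).Adj h J).groundStateFunctional
      ⁅(∑ u : TorusSite d L, (a u : ℂ) • siteCos M u),
        ⁅truncHamiltonian M (torusGraph d L).Adj h J, ∑ u : TorusSite d L, (a u : ℂ) • siteCos M u⁆⁆).re =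
      ∑ x : TorusSite d L, h / 2 * (a x ^ 2 *
        ((truncHamiltonian M (torusGraph d L).Adj h J).groundStateFunctional
          ((2 : ℂ) • (siteSin M x * siteSin M x) - (M : ℂ) • siteEdgeProj M x)).re) +
      ∑ x : TorusSite d L, ∑ y ∈ univ.filter ((torusGraph d L).Adj x), J / 2 *
        (a x ^ 2 * ((truncHamiltonian M (torusGraph d L).Adj h J).groundStateFunctional
            (⁅siteCos M x, ⁅siteCos M x, siteSin M x⁆⁆ * siteSin M y)).re +
          a y ^ 2 * ((truncHamiltonian M (torusGraph d L).Adj h J).groundStateFunctional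
            (siteSin M x * ⁅siteCos M y, ⁅siteCos M y, siteSin M y⁆⁆)).re +
          2 * a x * a y * ((truncHamiltonian M (torusGraph d L).Adj h J).groundStateFunctional
            (⁅siteCos M x, siteSin M x⁆ * ⁅siteCos M y, siteSin M y⁆)).re) := by
  rw [lie_lie_truncHamiltonian M (torusGraph d L).Adj (fun x => SimpleGraph.irrefl _) h J
    (fun u => (a u : ℂ)), map_add, Complex.add_re, map_sum, map_sum, Complex.re_sum, Complex.re_sum]
  simp only [siteEdgeProj]
  congr 1
  · refine sum_congr rfl fun x _ => ?_
    rw [LinearMap.map_smul, LinearMap.map_smul, smul_eq_mul, smul_eq_mul,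
      show ((a x : ℂ)) ^ 2 = ((a x ^ 2 : ℝ) : ℂ) by push_cast; ring, ← mul_assoc, ← Complex.ofReal_mul,
      Complex.re_ofReal_mul, mul_assoc]
  · refine sum_congr rfl fun x _ => ?_
    rw [map_sum, Complex.re_sum]
    refine sum_congr rfl fun y _ => ?_
    rw [LinearMap.map_smul, smul_eq_mul, Complex.re_ofReal_mul, map_add, map_add, LinearMap.map_smul,
      LinearMap.map_smul, LinearMap.map_smul, smul_eq_mul, smul_eq_mul, smul_eq_mul, Complex.add_re,
      Complex.add_re, show ((a x : ℂ)) ^ 2 = ((a x ^ 2 : ℝ) : ℂ) by push_cast; ring,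
      show ((a y : ℂ)) ^ 2 = ((a y ^ 2 : ℝ) : ℂ) by push_cast; ring,
      show (2 * (a x : ℂ) * (a y : ℂ)) = ((2 * a x * a y : ℝ) : ℂ) by push_cast; ring,
      Complex.re_ofReal_mul, Complex.re_ofReal_mul, Complex.re_ofReal_mul]

/-- **One real wave, bounded**: for `M ≥ 1`, `h, J ≥ 0`, `ε > 0`, with `π_x = Re ω(Π_x)`,
`Re ω([A,[H_M,A]]) ≤ Σ_x h a_x² + Σ_x Σ_{y∼x} (J/2)(a_x²(ε + π_x/(4ε)) + a_y²(ε + π_y/(4ε))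
  + |2a_x a_y|(π_x + π_y)/8)`. [folklore] -/
theorem re_groundStateFunctional_lie_lie_wave_le (hM : 1 ≤ M) {h J : ℝ} (hh : 0 ≤ h) (hJ : 0 ≤ J)
    {ε : ℝ} (hε : 0 < ε) (a : TorusSite d L → ℝ) :
    ((truncHamiltonian M (torusGraph d L).Adj h J).groundStateFunctional
      ⁅(∑ u : TorusSite d L, (a u : ℂ) • siteCos M u),
        ⁅truncHamiltonian M (torusGraph d L).Adj h J, ∑ u : TorusSite d L, (a u : ℂ) • siteCos M u⁆⁆).re ≤
      ∑ x : TorusSite d L, h * a x ^ 2 +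
      ∑ x : TorusSite d L, ∑ y ∈ univ.filter ((torusGraph d L).Adj x), J / 2 *
        (a x ^ 2 * (ε + ε⁻¹ / 4 *
            ((truncHamiltonian M (torusGraph d L).Adj h J).groundStateFunctional (siteEdgeProj M x)).re) +
          a y ^ 2 * (ε + ε⁻¹ / 4 *
            ((truncHamiltonian M (torusGraph d L).Adj h J).groundStateFunctional (siteEdgeProj M y)).re) +
          |2 * a x * a y| *
            ((((truncHamiltonian M (torusGraph d L).Adj h J).groundStateFunctional (siteEdgeProj M x)).re +
              ((truncHamiltonian M (torusGraph d L).Adj h J).groundStateFunctional (siteEdgeProj M y)).re) / 8)) := by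
  rw [re_groundStateFunctional_lie_lie_wave]
  refine add_le_add (sum_le_sum fun x _ => ?_) (sum_le_sum fun x _ => sum_le_sum fun y hy => ?_)
  · have hk := re_groundStateFunctional_kinetic_le (M := M) h J x
    have hax : 0 ≤ a x ^ 2 := sq_nonneg _
    have h2' : a x ^ 2 * ((truncHamiltonian M (torusGraph d L).Adj h J).groundStateFunctional
        ((2 : ℂ) • (siteSin M x * siteSin M x) - (M : ℂ) • siteEdgeProj M x)).re ≤ a x ^ 2 * 2 :=
      mul_le_mul_of_nonneg_left hk hax
    have h3' : h / 2 * (a x ^ 2 * ((truncHamiltonian M (torusGraph d L).Adj h J).groundStateFunctional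
        ((2 : ℂ) • (siteSin M x * siteSin M x) - (M : ℂ) • siteEdgeProj M x)).re) ≤
        h / 2 * (a x ^ 2 * 2) := mul_le_mul_of_nonneg_left h2' (by positivity)
    linarith
  · have hxy : x ≠ y := (torusGraph d L).ne_of_adj (mem_filter.1 hy).2
    have h1 := abs_re_groundStateFunctional_edgeTerm_le (M := M) hM h J hxy hε
    have h2 := abs_re_groundStateFunctional_edgeTerm_le' (M := M) hM h J hxy hε
    have h3 := abs_re_groundStateFunctional_edgeProd_le (M := M) hM h J hxy
    refine mul_le_mul_of_nonneg_left ?_ (by positivity)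
    have i1 := mul_le_mul_of_nonneg_left ((le_abs_self _).trans h1) (sq_nonneg (a x))
    have i2 := mul_le_mul_of_nonneg_left ((le_abs_self _).trans h2) (sq_nonneg (a y))
    have i3 : 2 * a x * a y * ((truncHamiltonian M (torusGraph d L).Adj h J).groundStateFunctional
        (⁅siteCos M x, siteSin M x⁆ * ⁅siteCos M y, siteSin M y⁆)).re ≤
        |2 * a x * a y| *
          ((((truncHamiltonian M (torusGraph d L).Adj h J).groundStateFunctional (siteEdgeProj M x)).re +
            ((truncHamiltonian M (torusGraph d L).Adj h J).groundStateFunctional (siteEdgeProj M y)).re) / 8) := by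
      refine (le_abs_self _).trans ?_
      rw [abs_mul]
      exact mul_le_mul_of_nonneg_left h3 (abs_nonneg _)
    linarith

/-- `Σ_{y ∼ x} 1 = 2d` and `Σ_x Σ_{y ∼ x} f(y) = 2d Σ_x f(x)` on the torus of side `L ≥ 3`.
[folklore] -/
theorem sum_sum_filter_torusGraph_adj_right (hL : 3 ≤ L) (f : TorusSite d L → ℝ) :
    ∑ x : TorusSite d L, ∑ y ∈ univ.filter ((torusGraph d L).Adj x), f y =
      2 * d * ∑ x : TorusSite d L, f x := by
  simp_rw [sum_filter_torusGraph_adj L hL]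
  have h1 : ∀ i : Fin d, ∑ x : TorusSite d L, f (x + Pi.single i 1) = ∑ x : TorusSite d L, f x :=
    fun i => Equiv.sum_comp (Equiv.addRight (Pi.single i (1 : ZMod L) : TorusSite d L)) f
  have h2 : ∀ i : Fin d, ∑ x : TorusSite d L, f (x - Pi.single i 1) = ∑ x : TorusSite d L, f x :=
    fun i => Equiv.sum_comp (Equiv.subRight (Pi.single i (1 : ZMod L) : TorusSite d L)) f
  have hA : ∑ x : TorusSite d L, ∑ i : Fin d, f (x + Pi.single i 1) = d * ∑ x : TorusSite d L, f x := by
    rw [Finset.sum_comm]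
    simp only [h1, sum_const, card_univ, Fintype.card_fin, nsmul_eq_mul]
  have hB : ∑ x : TorusSite d L, ∑ i : Fin d, f (x - Pi.single i 1) = d * ∑ x : TorusSite d L, f x := by
    rw [Finset.sum_comm]
    simp only [h2, sum_const, card_univ, Fintype.card_fin, nsmul_eq_mul]
  rw [sum_add_distrib, hA, hB]
  ring

/-- `Σ_x Σ_{y ∼ x} f(x) = 2d Σ_x f(x)` on the torus of side `L ≥ 3`. [folklore] -/
theorem sum_sum_filter_torusGraph_adj_left (hL : 3 ≤ L) (f : TorusSite d L → ℝ) :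
    ∑ x : TorusSite d L, ∑ _y ∈ univ.filter ((torusGraph d L).Adj x), f x =
      2 * d * ∑ x : TorusSite d L, f x := by
  simp_rw [sum_filter_torusGraph_adj L hL]
  simp only [sum_const, card_univ, Fintype.card_fin, nsmul_eq_mul, mul_sum]
  refine sum_congr rfl fun x _ => ?_
  ring

/-- `|2 cos α cos β| + |2 sin α sin β| ≤ 2` (from `|2ab| ≤ a² + b²`). [folklore] -/
theorem abs_two_mul_cos_add_abs_two_mul_sin_le (α β : ℝ) :
    |2 * Real.cos α * Real.cos β| + |2 * Real.sin α * Real.sin β| ≤ 2 := by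
  have key : ∀ a b : ℝ, |2 * a * b| ≤ a ^ 2 + b ^ 2 := by
    intro a b
    refine abs_le.2 ⟨?_, two_mul_le_add_sq a b⟩
    have h := two_mul_le_add_sq (-a) b
    rw [neg_sq] at h
    linarith
  have h1 := key (Real.cos α) (Real.cos β)
  have h2 := key (Real.sin α) (Real.sin β)
  linarith [Real.cos_sq_add_sin_sq α, Real.cos_sq_add_sin_sq β]

/-- **The double commutator of the two modes is small**: for `L ≥ 3`, `M ≥ 1`, `h, J ≥ 0` and every
`ε > 0`,
`Re ω([C_q,[H_M,C_q]]) + Re ω([D_q,[H_M,D_q]]) ≤ h L^d + J (2εd L^d + (d/(2ε) + d/2) Σ_x Re ω(Π_x))`.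
(In the continuum the right side is `h L^d`: `[cos φ,[(h/2)N², cos φ]] = h sin² φ ≤ h`,
[WojtkiewiczPuszStachura2016] §3.4, `𝓓_k ≤ 1/(4I)`; the `J`-terms are the truncation edge.)
[cite: WojtkiewiczPuszStachura2016, §3.4] [cite: KLS1988JSP, eq. (13)] -/
theorem re_lie_lie_modes_le (hL : 3 ≤ L) (hM : 1 ≤ M) {h J : ℝ} (hh : 0 ≤ h) (hJ : 0 ≤ J)
    {ε : ℝ} (hε : 0 < ε) (q : TorusSite d L) :
    ((truncHamiltonian M (torusGraph d L).Adj h J).groundStateFunctional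
        ⁅rotorCosMode L M q, ⁅truncHamiltonian M (torusGraph d L).Adj h J, rotorCosMode L M q⁆⁆).re +
      ((truncHamiltonian M (torusGraph d L).Adj h J).groundStateFunctional
        ⁅rotorSinMode L M q, ⁅truncHamiltonian M (torusGraph d L).Adj h J, rotorSinMode L M q⁆⁆).re ≤
      h * (L : ℝ) ^ d + J * (2 * ε * d * (L : ℝ) ^ d + (d / (2 * ε) + d / 2) *
        ∑ x : TorusSite d L,
          ((truncHamiltonian M (torusGraph d L).Adj h J).groundStateFunctional (siteEdgeProj M x)).re) := by
  set π : TorusSite d L → ℝ := fun x =>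
    ((truncHamiltonian M (torusGraph d L).Adj h J).groundStateFunctional (siteEdgeProj M x)).re with hπ
  have hπ0 : ∀ x, 0 ≤ π x := fun x => re_groundStateFunctional_siteEdgeProj_nonneg (M := M) h J x
  have hc := re_groundStateFunctional_lie_lie_wave_le L M hM hh hJ hε (fun x => Real.cos (torusPhase L q x))
  have hs := re_groundStateFunctional_lie_lie_wave_le L M hM hh hJ hε (fun x => Real.sin (torusPhase L q x))
  rw [rotorCosMode, rotorSinMode]
  refine (add_le_add hc hs).trans ?_
  -- kinetic terms: `cos² + sin² = 1`
  have hkin : ∑ x : TorusSite d L, h * Real.cos (torusPhase L q x) ^ 2 +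
      ∑ x : TorusSite d L, h * Real.sin (torusPhase L q x) ^ 2 = h * (L : ℝ) ^ d := by
    rw [← sum_add_distrib, sum_congr rfl fun x _ => by
      rw [← mul_add, Real.cos_sq_add_sin_sq, mul_one], sum_const, card_univ, nsmul_eq_mul,
      Fintype.card_pi, prod_const, ZMod.card, card_univ, Fintype.card_fin, Nat.cast_pow, mul_comm]
  -- bond terms, pointwise in `(x, y)`
  have hbond : ∀ x y : TorusSite d L,
      J / 2 * (Real.cos (torusPhase L q x) ^ 2 * (ε + ε⁻¹ / 4 * π x) +
          Real.cos (torusPhase L q y) ^ 2 * (ε + ε⁻¹ / 4 * π y) +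
          |2 * Real.cos (torusPhase L q x) * Real.cos (torusPhase L q y)| * ((π x + π y) / 8)) +
        J / 2 * (Real.sin (torusPhase L q x) ^ 2 * (ε + ε⁻¹ / 4 * π x) +
          Real.sin (torusPhase L q y) ^ 2 * (ε + ε⁻¹ / 4 * π y) +
          |2 * Real.sin (torusPhase L q x) * Real.sin (torusPhase L q y)| * ((π x + π y) / 8)) ≤
        J / 2 * (2 * ε + (ε⁻¹ / 4 + 1 / 4) * π x + (ε⁻¹ / 4 + 1 / 4) * π y) := by
    intro x y
    have h1 := Real.cos_sq_add_sin_sq (torusPhase L q x)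
    have h2 := Real.cos_sq_add_sin_sq (torusPhase L q y)
    have h3 := abs_two_mul_cos_add_abs_two_mul_sin_le (torusPhase L q x) (torusPhase L q y)
    have hp : 0 ≤ (π x + π y) / 8 := div_nonneg (add_nonneg (hπ0 x) (hπ0 y)) (by norm_num)
    rw [← mul_add]
    refine mul_le_mul_of_nonneg_left ?_ (by positivity)
    have e : Real.cos (torusPhase L q x) ^ 2 * (ε + ε⁻¹ / 4 * π x) +
        Real.cos (torusPhase L q y) ^ 2 * (ε + ε⁻¹ / 4 * π y) +
        |2 * Real.cos (torusPhase L q x) * Real.cos (torusPhase L q y)| * ((π x + π y) / 8) +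
        (Real.sin (torusPhase L q x) ^ 2 * (ε + ε⁻¹ / 4 * π x) +
          Real.sin (torusPhase L q y) ^ 2 * (ε + ε⁻¹ / 4 * π y) +
          |2 * Real.sin (torusPhase L q x) * Real.sin (torusPhase L q y)| * ((π x + π y) / 8)) =
        (Real.cos (torusPhase L q x) ^ 2 + Real.sin (torusPhase L q x) ^ 2) * (ε + ε⁻¹ / 4 * π x) +
        (Real.cos (torusPhase L q y) ^ 2 + Real.sin (torusPhase L q y) ^ 2) * (ε + ε⁻¹ / 4 * π y) +
        (|2 * Real.cos (torusPhase L q x) * Real.cos (torusPhase L q y)| +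
          |2 * Real.sin (torusPhase L q x) * Real.sin (torusPhase L q y)|) * ((π x + π y) / 8) := by
      ring
    rw [e, h1, h2, one_mul, one_mul]
    have h4 := mul_le_mul_of_nonneg_right h3 hp
    linarith
  have hsum : ∑ x : TorusSite d L, ∑ y ∈ univ.filter ((torusGraph d L).Adj x),
      J / 2 * (2 * ε + (ε⁻¹ / 4 + 1 / 4) * π x + (ε⁻¹ / 4 + 1 / 4) * π y) =
      J * (2 * ε * d * (L : ℝ) ^ d + (d / (2 * ε) + d / 2) * ∑ x : TorusSite d L, π x) := by
    have e1 : ∀ x : TorusSite d L, ∑ y ∈ univ.filter ((torusGraph d L).Adj x),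
        J / 2 * (2 * ε + (ε⁻¹ / 4 + 1 / 4) * π x + (ε⁻¹ / 4 + 1 / 4) * π y) =
        ∑ y ∈ univ.filter ((torusGraph d L).Adj x), J / 2 * (2 * ε + (ε⁻¹ / 4 + 1 / 4) * π x) +
          ∑ y ∈ univ.filter ((torusGraph d L).Adj x), J / 2 * ((ε⁻¹ / 4 + 1 / 4) * π y) := by
      intro x
      rw [← sum_add_distrib]
      refine sum_congr rfl fun y _ => ?_
      ring
    rw [sum_congr rfl fun x _ => e1 x, sum_add_distrib,
      sum_sum_filter_torusGraph_adj_left L hL, sum_sum_filter_torusGraph_adj_right L hL, ← mul_sum,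
      ← mul_sum, sum_add_distrib, sum_const, card_univ, nsmul_eq_mul, Fintype.card_pi, prod_const,
      ZMod.card, card_univ, Fintype.card_fin, Nat.cast_pow, ← mul_sum]
    field_simp
    ring
  have hb2 := sum_le_sum (s := (univ : Finset (TorusSite d L))) fun x _ =>
    sum_le_sum (s := univ.filter ((torusGraph d L).Adj x)) fun y _ => hbond x y
  rw [hsum] at hb2
  simp only [sum_add_distrib] at hb2 ⊢
  linarith [hkin, hb2]

end DoubleCommutatorBound

end QuantumRotor

end Literature.MathematicalPhysics.QuantumLattice
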